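import Summits.QuantumAdvantage.QuantumAdvantage.Theses.PathInvolution
import Literature.Computability.Complexity.OracleBPPAmplification

/-!
# Line `birth` — BC3 skeleton for the crux `PinvCriterion` (stmt-QuantumAdvantage-2014)

Route `PathInvolution` (route-QuantumAdvantage-PathInvolution; refutation side: `closes` concludes
`¬ QuantumAdvantage` from `PinvCriterion` and `PinvTarget`), crux rank 2:

  `PinvCriterion` — HADAMARD-INFLUENCE DEQUANTIZATION CRITERION over `toffoliH = {H, X, CNOT, TOF}`:
  a uniform oracle-free Toffoli+H family whose total REACHABLE Hadamard influence is `≤ 1/10` on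
  every input decides (gap `2/3, 1/3`) only languages in `BPP`.  `ust L` is the dephased (coin-flip)
  column-stochastic chain of the gate list `L` (product of the entrywise-`|·|²` gate matrices, first
  gate rightmost), `ust (L.take j) s s₀` the dephased probability of sitting at `s` just before gate
  `j`, `∑_{y ∈ accept} ust (L.drop (j+1)) y s'` the dephased acceptance probability of the walk
  continued after gate `j` from `s'`.

THE LINE (= the route's own proof plan (i)–(iii) for this node, cut into its three genuinely
different pieces; k = 3, glue = thresholds + the tree's BPP error reduction):

* `stub_reachability` (M; matrices only) — SUPPORT TRANSFER: a basis state with non-zero QUANTUM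
  amplitude after a gate list is reachable by the DEPHASED walk (`|∑_paths ∏ U| > 0 ⇒ some path has
  all factors ≠ 0 ⇒ ∑_paths ∏ |U|² > 0`).  This is exactly the "reachability refinement" the route
  header calls essential (coins on wires the quantum state never splits on must not be charged).
* `stub_interferenceBound` (L; LOAD-BEARING analytic step = card Lemma 2 at matrix level) — for an
  oracle-free Toffoli+H circuit `C` on `N` wires run on `|s₀⟩`:
  `|P_quantum(accept) − P_deph(accept)| ≤ ∑_j κ_j` whenever `2κ_j` dominates the dephased
  output-sensitivity `|f_{j+1}(s[w:=0]) − f_{j+1}(s[w:=1])|` of every Hadamard `j` (wire `w`) at every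
  `s` such that BOTH `s` and `s ⊕ e_w` carry non-zero amplitude in the state `A_j = U_{<j}|s₀⟩`.
  Proof plan (4 independent refuter re-derivations on the item): hybrids `G_k` = quantum prefix of
  length `k`, full dephasing, classical suffix; `G_0 = P_deph`, `G_T = P_quantum`; permutation gates
  (X/CNOT/TOF) commute with dephasing so `G_{k+1} = G_k`; for `H` on wire `w`,
  `G_{k+1} − G_k = ∑_{u : u_w = 0} D_k(u) · Re(A_k(u) conj A_k(u ⊕ e_w))`, then
  `2|ab| ≤ |a|² + |b|²` and `∑_s |A_k(s)|² = 1` (`toffoliH_isUnitary_holds`,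
  `QCircuit.toMatrix_mem_unitaryGroup_holds`).  Quantum side typed as `QCircuit.probEvent`, prefix
  states as `QCircuit.runOn` of `⟨C.gates.take j⟩` (existing decls).
* `stub_dephasedSampler` (XL; machine construction) — EXACT CLASSICAL SAMPLING OF THE DEPHASED WALK:
  for a uniform oracle-free Toffoli+H family `F` there are `L' ∈ P` and a coin polynomial `p` with
  `Pr_{y ∈ {0,1}^{p|x|}}[⟨x,y⟩ ∈ L'] = P_deph(F, x)` for every `x` (decode `⟨x,y⟩`, run the
  uniformity machine on `1^{|x|}`, walk the gate list classically using coin `y_i` at the `i`-th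
  Hadamard — `H ↦` fresh fair bit, `X/CNOT/TOF ↦` the permutation; `p ≥ size` from
  `QCircuitFamily.IsUniform.isPolySize_holds`).  This is the `bp·P` sampler the item's
  why-it-might-fail names as the typing risk (inline `Encodable` instance carried verbatim).
* Glue `PinvCriterion_of` (sorry-free): for `x` take the route's `κ` (budget `≤ 1/10`); reachability
  turns the crux's dephased-reachability premises into the amplitude premises of the bound, so
  `|p(x) − P_deph(x)| ≤ 1/10`; with the gap, `x ∈ L ⇒ P_deph ≥ 17/30`, `x ∉ L ⇒ P_deph ≤ 13/30`, i.e.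
  `L ∈ bpErr P (13/30)` via the sampler (`uniformProb_compl` on the YES side), and
  `bpErr_P_subset_BPP (13/30 < 1/2)` (Arora–Barak Thm 7.10, PROVED in
  `OracleBPPAmplification.lean`) gives `L ∈ BPP`.  `PinvCriterion_of` (hypotheses = the stub statements via
  the name-keyed aliases `Registered.stub_*`) and `PinvCriterion_proof := PinvCriterion_of stub_reachability
  stub_interferenceBound stub_dephasedSampler` are the only theorems whose head is the crux (BY NAME).

Disproof used: none exists for this crux (`ledger crux ls stmt-QuantumAdvantage-2014`: no workfiles —
no `Disproof.lean`, no landed `Theorems/PinvCriterion/Negative/*`); `ledger negatives --problem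
QuantumAdvantage` (6 refuted statements: RegulatorThird, ShorLocallyDark, CubicStability,
SpinorFlattening-GaussRankPoly, KummerSector, SeparableFrames) has nothing on dephasing / Toffoli+H /
influences, so no stub restates a refuted statement.

Sources: BennettBernsteinBrassardVazirani1997 (hybrid argument), Stahlke2014 (arXiv:1305.2186),
Vandennest2011 (arXiv:0911.1624), Amy2019 (arXiv:1805.06908, rule [HH]), AdlemanDeMarraisHuang1997,
AroraBarak2009 (Def 7.3, Thm 7.10), Shi2003.

`sorry` occurs ONLY in the three `stub_*` theorems.
-/

-- `Summit.<Summit>.<Problem>`: for the single-conjunct summit the duplicate `QuantumAdvantage.QuantumAdvantage` is mandated.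
set_option linter.dupNamespace false

namespace Summit.QuantumAdvantage.QuantumAdvantage.Cruxes.PinvCriterion.Birth

open Summit.QuantumAdvantage.QuantumAdvantage.Theses.PathInvolution
open scoped BigOperators Classical Matrix ComplexConjugate
open Literature.Computability.Complexity Literature.Computability.Cryptography
open Literature.Computability.QuantumComplexity

/-! ## The three registered stubs (signatures fully qualified; registered verbatim) -/

/-- **Stub 1 — support transfer (quantum reachability ⇒ dephased reachability).**  For every gate
list `gs` over Toffoli+H on `N` wires and basis states `s₀, s`: if `⟨s| U_gs |s₀⟩ ≠ 0` then the
dephased column-stochastic chain `ust gs` reaches `s` from `s₀` with positive probability.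
(`|∑_paths ∏ U_i| > 0` forces a path with all factors non-zero, whose `∏ |U_i|²` is a positive term
of the non-negative sum `(ust gs) s s₀`; induction on `gs` with `Matrix.mulVec`.)  Holds for every
gate set and needs no oracle-freeness (`ust` and `runOn` both use the empty oracle `0`).
Leans on: `QCircuit.runOn`, `QGate.toMatrix`, `basisState`.  [folklore; AdlemanDeMarraisHuang1997 §6] -/
theorem stub_reachability :
    ∀ (ust : {M : ℕ} → List (Literature.Computability.Cryptography.QGate Literature.Computability.Cryptography.toffoliH M) →
        Matrix (Literature.Computability.Cryptography.QReg M) (Literature.Computability.Cryptography.QReg M) ℝ),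
      (∀ (M : ℕ) (L : List (Literature.Computability.Cryptography.QGate Literature.Computability.Cryptography.toffoliH M)),
        ust L = (L.map fun g => (g.toMatrix 0).map fun a : ℂ => ‖a‖ ^ 2).reverse.prod) →
      ∀ (N : ℕ) (gs : List (Literature.Computability.Cryptography.QGate Literature.Computability.Cryptography.toffoliH N))
        (s₀ s : Literature.Computability.Cryptography.QReg N),
        ((⟨gs⟩ : Literature.Computability.Cryptography.QCircuit Literature.Computability.Cryptography.toffoliH N).runOn 0
            (Literature.Computability.Cryptography.basisState s₀)) s ≠ 0 →
        0 < ust gs s s₀ := by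
  sorry

/-- **Stub 2 — the interference bound (card Lemma 2 at matrix level; LOAD-BEARING).**  For an
oracle-free Toffoli+H circuit `C` on `N` wires run on `|s₀⟩` and every profile `κ ≥ 0` such that, for
each Hadamard `j` on wire `w` and each `s` with BOTH `s` and `s ⊕ e_w` of non-zero amplitude in the
prefix state `U_{<j}|s₀⟩`, `2κ_j` dominates the difference of the dephased acceptance probabilities of
the walk continued after `j` from `s[w:=0]` and from `s[w:=1]`:
`|probEvent(accept) − ∑_{y ∈ accept} (ust C.gates) y s₀| ≤ ∑_{j < |C|} κ_j`.
Why it might fail AS TYPED only: `.reverse.prod` column convention, `take j`/`drop (j+1)` indexing,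
the `N = 0` junk register (both sides `0`).  Leans on: `QCircuit.probEvent`, `QCircuit.runOn`,
`QCircuit.acceptEvent`, `toffoliH_isUnitary_holds`, `QCircuit.toMatrix_mem_unitaryGroup_holds`,
`emb_one_eq_wireEmb`.  Sources: BennettBernsteinBrassardVazirani1997 (hybrids), Stahlke2014 §6.4,
Vandennest2011 Thm 1, Amy2019 §3.1 [HH]. -/
theorem stub_interferenceBound :
    ∀ (ust : {M : ℕ} → List (Literature.Computability.Cryptography.QGate Literature.Computability.Cryptography.toffoliH M) →
        Matrix (Literature.Computability.Cryptography.QReg M) (Literature.Computability.Cryptography.QReg M) ℝ),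
      (∀ (M : ℕ) (L : List (Literature.Computability.Cryptography.QGate Literature.Computability.Cryptography.toffoliH M)),
        ust L = (L.map fun g => (g.toMatrix 0).map fun a : ℂ => ‖a‖ ^ 2).reverse.prod) →
      ∀ (N : ℕ) (C : Literature.Computability.Cryptography.QCircuit Literature.Computability.Cryptography.toffoliH N),
        C.IsOracleFree →
        ∀ (s₀ : Literature.Computability.Cryptography.QReg N) (κ : ℕ → ℝ), (∀ j, 0 ≤ κ j) →
          (∀ (j : ℕ) (hj : j < C.gates.length) (w : Fin N) (s : Literature.Computability.Cryptography.QReg N),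
            C.gates.get ⟨j, hj⟩ =
                Literature.Computability.Cryptography.QGate.gate Literature.Computability.Cryptography.ToffoliHOp.H
                  (Literature.Computability.QuantumComplexity.wireEmb w) →
            ((⟨C.gates.take j⟩ : Literature.Computability.Cryptography.QCircuit Literature.Computability.Cryptography.toffoliH N).runOn 0
                (Literature.Computability.Cryptography.basisState s₀)) s ≠ 0 →
            ((⟨C.gates.take j⟩ : Literature.Computability.Cryptography.QCircuit Literature.Computability.Cryptography.toffoliH N).runOn 0
                (Literature.Computability.Cryptography.basisState s₀)) (Function.update s w (!s w)) ≠ 0 →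
            |(∑ y, if y ∈ Literature.Computability.Cryptography.QCircuit.acceptEvent N then
                  ust (C.gates.drop (j + 1)) y (Function.update s w false) else 0) -
                (∑ y, if y ∈ Literature.Computability.Cryptography.QCircuit.acceptEvent N then
                  ust (C.gates.drop (j + 1)) y (Function.update s w true) else 0)| ≤ 2 * κ j) →
          |C.probEvent 0 (Literature.Computability.Cryptography.basisState s₀)
                (Literature.Computability.Cryptography.QCircuit.acceptEvent N) -
              (∑ y, if y ∈ Literature.Computability.Cryptography.QCircuit.acceptEvent N then ust C.gates y s₀ else 0)| ≤
            ∑ j ∈ Finset.range C.gates.length, κ j := by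
  sorry

/-- **Stub 3 — exact classical sampler of the dephased walk (the `bp·P` machine).**  For every
uniform oracle-free Toffoli+H family `F` there are a language `L' ∈ P` and a coin polynomial `p` such
that for every input `x` the fraction of coin strings `y ∈ {0,1}^{p |x|}` with `⟨x, y⟩ ∈ L'` is
EXACTLY the dephased acceptance probability `∑_{y ∈ accept} (ust (F.circ |x|).gates) y |x 0…0⟩`
(decode the pairing; produce `⟨F.circ |x|⟩` by the uniformity machine; walk the gate list
classically — `H ↦` the next coin of `y`, `X/CNOT/TOF ↦` the permutation, ancillas `0`; accept iff
wire `0` exists and reads `1`; `p ≥ size ≥ #H` by `IsUniform.isPolySize_holds`, surplus coins ignored).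
Why it might fail AS TYPED: the inline `Encodable ToffoliHOp` instance (defeq to the canonical one),
and the TM plumbing (`PolyTimeComputable` composition: unary padding, `sigmaEncode` parsing, `boolPair`
decoding) — XL but standard; the identity itself is exact because each dephased `H` is a fresh fair
bit.  Leans on: `QCircuitFamily.IsUniform`, `Classes.P`, `uniformProb`, `boolPair`, `padInput`.
Sources: AroraBarak2009 Def 7.3 / §6.1, BernsteinVazirani1997 §8, Shi2003, Vandennest2011 Thm 1. -/
theorem stub_dephasedSampler :
    ∀ (ust : {M : ℕ} → List (Literature.Computability.Cryptography.QGate Literature.Computability.Cryptography.toffoliH M) →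
        Matrix (Literature.Computability.Cryptography.QReg M) (Literature.Computability.Cryptography.QReg M) ℝ),
      (∀ (M : ℕ) (L : List (Literature.Computability.Cryptography.QGate Literature.Computability.Cryptography.toffoliH M)),
        ust L = (L.map fun g => (g.toMatrix 0).map fun a : ℂ => ‖a‖ ^ 2).reverse.prod) →
      ∀ F : Literature.Computability.Cryptography.QCircuitFamily Literature.Computability.Cryptography.toffoliH,
        F.IsOracleFree →
        @Literature.Computability.Cryptography.QCircuitFamily.IsUniform Literature.Computability.Cryptography.toffoliH
          (inferInstanceAs (Encodable Literature.Computability.Cryptography.ToffoliHOp)) F →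
        ∃ L' ∈ Literature.Computability.Complexity.Classes.P, ∃ p : Polynomial ℕ, ∀ x : List Bool,
          Literature.Computability.Complexity.uniformProb (p.eval x.length)
              {y : List Bool | Literature.Computability.Complexity.boolPair x y ∈ L'} =
            ∑ y, if y ∈ Literature.Computability.Cryptography.QCircuit.acceptEvent (x.length + F.ancillas x.length) then
              ust (F.circ x.length).gates y
                (Literature.Computability.Cryptography.padInput x.get (F.ancillas x.length)) else 0 := by
  sorry

/-! ## Name-keyed aliases of the stub statements

The A12 skeleton audit (`#h21_check_skeleton`, run by `ledger skeleton check`) admits as hypotheses of the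
theorem concluding the crux only registered obligations or DECLARED STUBS BY NAME (last name component =
a stub name).  The three `abbrev`s below are the stub signatures verbatim, keyed by the stub names, so
that `PinvCriterion_of` can take the stub STATEMENTS as hypotheses (the registrar's required shape
`<stub sigs> → PinvCriterion`) and still pass the audit; `PinvCriterion_proof` checks that each alias is
literally the corresponding stub's type. They are aliases, not new obligations (the HarnessLib `stub` attribute is gate-reserved, so they stay untagged;
the advisory file audit therefore lists them as `vendored-fact`, which is expected for a Lines/ workfile). -/

namespace Registered

/-- Alias (verbatim) of the statement of `stub_reachability`, keyed by the stub name. [alias] -/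
abbrev stub_reachability : Prop :=
    ∀ (ust : {M : ℕ} → List (Literature.Computability.Cryptography.QGate Literature.Computability.Cryptography.toffoliH M) →
        Matrix (Literature.Computability.Cryptography.QReg M) (Literature.Computability.Cryptography.QReg M) ℝ),
      (∀ (M : ℕ) (L : List (Literature.Computability.Cryptography.QGate Literature.Computability.Cryptography.toffoliH M)),
        ust L = (L.map fun g => (g.toMatrix 0).map fun a : ℂ => ‖a‖ ^ 2).reverse.prod) →
      ∀ (N : ℕ) (gs : List (Literature.Computability.Cryptography.QGate Literature.Computability.Cryptography.toffoliH N))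
        (s₀ s : Literature.Computability.Cryptography.QReg N),
        ((⟨gs⟩ : Literature.Computability.Cryptography.QCircuit Literature.Computability.Cryptography.toffoliH N).runOn 0
            (Literature.Computability.Cryptography.basisState s₀)) s ≠ 0 →
        0 < ust gs s s₀

/-- Alias (verbatim) of the statement of `stub_interferenceBound`, keyed by the stub name. [alias] -/
abbrev stub_interferenceBound : Prop :=
    ∀ (ust : {M : ℕ} → List (Literature.Computability.Cryptography.QGate Literature.Computability.Cryptography.toffoliH M) →
        Matrix (Literature.Computability.Cryptography.QReg M) (Literature.Computability.Cryptography.QReg M) ℝ),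
      (∀ (M : ℕ) (L : List (Literature.Computability.Cryptography.QGate Literature.Computability.Cryptography.toffoliH M)),
        ust L = (L.map fun g => (g.toMatrix 0).map fun a : ℂ => ‖a‖ ^ 2).reverse.prod) →
      ∀ (N : ℕ) (C : Literature.Computability.Cryptography.QCircuit Literature.Computability.Cryptography.toffoliH N),
        C.IsOracleFree →
        ∀ (s₀ : Literature.Computability.Cryptography.QReg N) (κ : ℕ → ℝ), (∀ j, 0 ≤ κ j) →
          (∀ (j : ℕ) (hj : j < C.gates.length) (w : Fin N) (s : Literature.Computability.Cryptography.QReg N),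
            C.gates.get ⟨j, hj⟩ =
                Literature.Computability.Cryptography.QGate.gate Literature.Computability.Cryptography.ToffoliHOp.H
                  (Literature.Computability.QuantumComplexity.wireEmb w) →
            ((⟨C.gates.take j⟩ : Literature.Computability.Cryptography.QCircuit Literature.Computability.Cryptography.toffoliH N).runOn 0
                (Literature.Computability.Cryptography.basisState s₀)) s ≠ 0 →
            ((⟨C.gates.take j⟩ : Literature.Computability.Cryptography.QCircuit Literature.Computability.Cryptography.toffoliH N).runOn 0
                (Literature.Computability.Cryptography.basisState s₀)) (Function.update s w (!s w)) ≠ 0 →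
            |(∑ y, if y ∈ Literature.Computability.Cryptography.QCircuit.acceptEvent N then
                  ust (C.gates.drop (j + 1)) y (Function.update s w false) else 0) -
                (∑ y, if y ∈ Literature.Computability.Cryptography.QCircuit.acceptEvent N then
                  ust (C.gates.drop (j + 1)) y (Function.update s w true) else 0)| ≤ 2 * κ j) →
          |C.probEvent 0 (Literature.Computability.Cryptography.basisState s₀)
                (Literature.Computability.Cryptography.QCircuit.acceptEvent N) -
              (∑ y, if y ∈ Literature.Computability.Cryptography.QCircuit.acceptEvent N then ust C.gates y s₀ else 0)| ≤
            ∑ j ∈ Finset.range C.gates.length, κ j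

/-- Alias (verbatim) of the statement of `stub_dephasedSampler`, keyed by the stub name. [alias] -/
abbrev stub_dephasedSampler : Prop :=
    ∀ (ust : {M : ℕ} → List (Literature.Computability.Cryptography.QGate Literature.Computability.Cryptography.toffoliH M) →
        Matrix (Literature.Computability.Cryptography.QReg M) (Literature.Computability.Cryptography.QReg M) ℝ),
      (∀ (M : ℕ) (L : List (Literature.Computability.Cryptography.QGate Literature.Computability.Cryptography.toffoliH M)),
        ust L = (L.map fun g => (g.toMatrix 0).map fun a : ℂ => ‖a‖ ^ 2).reverse.prod) →
      ∀ F : Literature.Computability.Cryptography.QCircuitFamily Literature.Computability.Cryptography.toffoliH,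
        F.IsOracleFree →
        @Literature.Computability.Cryptography.QCircuitFamily.IsUniform Literature.Computability.Cryptography.toffoliH
          (inferInstanceAs (Encodable Literature.Computability.Cryptography.ToffoliHOp)) F →
        ∃ L' ∈ Literature.Computability.Complexity.Classes.P, ∃ p : Polynomial ℕ, ∀ x : List Bool,
          Literature.Computability.Complexity.uniformProb (p.eval x.length)
              {y : List Bool | Literature.Computability.Complexity.boolPair x y ∈ L'} =
            ∑ y, if y ∈ Literature.Computability.Cryptography.QCircuit.acceptEvent (x.length + F.ancillas x.length) then
              ust (F.circ x.length).gates y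
                (Literature.Computability.Cryptography.padInput x.get (F.ancillas x.length)) else 0

end Registered

/-! ## Sorry-free glue -/

/-- Threshold bookkeeping, YES side: `2/3 ≤ p`, `|p − d| ≤ b ≤ 1/10` give `1 − d ≤ 13/30`. [folklore] -/
theorem yes_side {p d b : ℝ} (hp : 2 / 3 ≤ p) (hb : |p - d| ≤ b) (hb' : b ≤ 1 / 10) :
    1 - d ≤ 13 / 30 := by
  have h := (abs_sub_le_iff.1 (hb.trans hb')).1
  linarith

/-- Threshold bookkeeping, NO side: `p ≤ 1/3`, `|p − d| ≤ b ≤ 1/10` give `d ≤ 13/30`. [folklore] -/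
theorem no_side {p d b : ℝ} (hp : p ≤ 1 / 3) (hb : |p - d| ≤ b) (hb' : b ≤ 1 / 10) :
    d ≤ 13 / 30 := by
  have h := (abs_sub_le_iff.1 (hb.trans hb')).2
  linarith

/-- **The skeleton theorem**: the crux `PinvCriterion` BY NAME from the three stub statements
(hypotheses = the stub signatures verbatim — the name-keyed aliases `Registered.stub_*` — in registration order).  Given `F`, `L` with gap
`(2/3, 1/3)` and the influence budget: the sampler gives `L' ∈ P`, `p` with coin-fraction `= P_deph`;
for each `x`, reachability upgrades the crux's dephased-reachability premises to the amplitude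
premises of the interference bound, so `|acceptProbOn 0 x − P_deph(x)| ≤ ∑ κ ≤ 1/10`
(`QCircuit.acceptProb_eq_probEvent`); hence the error fraction of `L'` against `L` is `≤ 13/30` on both
sides (`uniformProb_compl` on the YES side), i.e. `L ∈ bpErr P (13/30) ⊆ BPP`
(`bpErr_P_subset_BPP`, Arora–Barak Thm 7.10, proved in the tree). -/
theorem PinvCriterion_of
    (hR : Registered.stub_reachability) (hB : Registered.stub_interferenceBound)
    (hS : Registered.stub_dephasedSampler) : PinvCriterion := by
  intro ust hust F hOF hU hκ L hgap
  obtain ⟨L', hL'P, p, hp⟩ := hS ust hust F hOF hU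
  refine Literature.Computability.Complexity.bpErr_P_subset_BPP
    (show (13 / 30 : ℝ) < 1 / 2 by norm_num) ⟨L', hL'P, p, fun x => ?_⟩
  obtain ⟨κ, hκ0, hsum, hinf⟩ := hκ x
  -- the interference bound for `F.circ |x|` on `|x 0…0⟩`, its amplitude premises discharged through
  -- the crux's dephased-reachability premises by `hR`
  have hb := hB ust hust _ (F.circ x.length) (hOF x.length)
    (Literature.Computability.Cryptography.padInput x.get (F.ancillas x.length)) κ hκ0
    (fun j hj w s hg h₁ h₂ => hinf j hj w s hg (hR ust hust _ _ _ _ h₁) (hR ust hust _ _ _ _ h₂))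
  have hacc : F.acceptProbOn 0 x =
      (F.circ x.length).probEvent 0
        (Literature.Computability.Cryptography.basisState
          (Literature.Computability.Cryptography.padInput x.get (F.ancillas x.length)))
        (Literature.Computability.Cryptography.QCircuit.acceptEvent (x.length + F.ancillas x.length)) :=
    Literature.Computability.Cryptography.QCircuit.acceptProb_eq_probEvent 0 (F.circ x.length) x.get
  rw [← hacc] at hb
  by_cases hx : x ∈ L
  · have hset : {y : List Bool | ¬ (Literature.Computability.Complexity.boolPair x y ∈ L' ↔ x ∈ L)} =
        {y : List Bool | Literature.Computability.Complexity.boolPair x y ∈ L'}ᶜ := by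
      ext y; simp [hx]
    rw [hset, Literature.Computability.Complexity.uniformProb_compl, hp x]
    exact yes_side ((hgap x).1 hx) hb hsum
  · have hset : {y : List Bool | ¬ (Literature.Computability.Complexity.boolPair x y ∈ L' ↔ x ∈ L)} =
        {y : List Bool | Literature.Computability.Complexity.boolPair x y ∈ L'} := by
      ext y; simp [hx]
    rw [hset, hp x]
    exact no_side ((hgap x).2 hx) hb hsum

/-- **The skeleton as the crux proof-to-be** (obligation-graph §3.3 shape
`theorem <Crux>_proof : <crux decl> := <Crux>_of stub₁ … stubₖ`): it typechecks the composition
against the stubs EXACTLY as stated and is the term that becomes the proof of item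
stmt-QuantumAdvantage-2014 once the three `stub_*` bodies are discharged; until then its ONLY
`sorry`s are the three inside `stub_reachability`, `stub_interferenceBound`, `stub_dephasedSampler`
(audit: not closed — `sorryAx` via the stubs; `PinvCriterion_of` itself is closed under the
standard axioms). -/
theorem PinvCriterion_proof : PinvCriterion :=
  PinvCriterion_of stub_reachability stub_interferenceBound stub_dephasedSampler

end Summit.QuantumAdvantage.QuantumAdvantage.Cruxes.PinvCriterion.Birth
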